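import Summits.Parity.GeneralizedHardyLittlewood.Theorems.FordMaynardSieveConst01651SieveConst01651LinePart07
import HarnessLib

/-!
# Route `FordMaynardSieveConst01651`, target `SieveConst01651` (stmt-Parity-19185): line `sieve_decomposition` re-homed — proofs, part 8 of 11 (file 9 of 12)

File 9 of 12 of the VERBATIM re-homing under `Theorems/` of the registered line skeleton
`Summits/Parity/GeneralizedHardyLittlewood/Cruxes/SieveConst01651/Lines/sieve_decomposition.lean` (v21, sha16
`ada6d0765119a11e`; author seat `linewriter-parity-smallroutes-1`, g0 v1–v20 / g1 v21): Ford–Maynard, Theorem 7.3 (a) at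
`P = (1/2, 0, ν)` with CLOSED support, cut along arXiv:2407.14368 §7.2 / §6.2, composed down to the route target
`Summit.Parity.GeneralizedHardyLittlewood.Theses.FordMaynardSieveConst01651.SieveConst01651`.  Namespace
`Summit.Parity.GeneralizedHardyLittlewood.FordMaynardSieveConst01651SieveDecomposition` (fresh; the `Cruxes` copy keeps its own), files of
≤ 400 lines chained by import; the three registered stubs are replaced by their landed proofs
(`…StubSignClauseFive` p834287, `…StubCertValuePos` p837763, `…TypeIIRegion` p833045), so the skeleton's composition
`SieveConst01651_of_stubs` (last part) is sorry-free.  Mathematics, statements and comments are the linewriter's; this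
re-homing (hand `leafhand-parity-fordmaynardsieveco-2` g4) only moved the definitions (`Eset`, `sliceTest`, `mainG1`, `vk`,
the `Signature.*` statement abbreviations, `Phi`, `innerI`, `jumpSet`, `gval`, `symmExt`, `idxProd`, `gam`) into the first
file, added docstrings where missing, and renamed two unused binders.
Declarations in this part: `sqfreeMainTerm_of_slice`, `isSymmetric_hfun`, `rpow_lt_iff_lt_log_div`, `wseq_hfun_eq`, `SFkset_subset_window`, `sum_SFkset_eq_Vsum`, `sliceMainTerm_of_Vsum`, `VsumMainTerm_of`, `injSum_hfun_of_ne`, `Vsum_hfun_eq`, `VsumIntegral_of_injSum`, `exists_abs_apply_le`, `exists_abs_starSum_le`, `hfun_ne_zero_imp`, `exists_abs_hfun_le`, `hrho_one`.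

References: [FordMaynard2024PrimeSieves] K. Ford, J. Maynard, *On the theory of prime producing sieves*, arXiv:2407.14368,
Theorem 7.3 (a), Proposition 7.19, §6.2, §7.2, §8.2.
-/

noncomputable section

open Finset
open Literature.NumberTheory.Sieve Literature.NumberTheory.Sieve.FordMaynard Literature.Barriers.Parity.FordMaynard
open Summit.Parity.GeneralizedHardyLittlewood.FordMaynardSieveConst01651SieveConst01651
  (hfun Admissible hfun_apply hfun_of_ne pvec roughPart smoothPart Gwt Hwt window IsRough Nset Rset mem_window mem_Nset mem_Rset
   coneCert openSmall stub_hkPieces stub_coneCertClosed_of_residues' coneCert_signClause_five_of_generic)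

namespace Summit.Parity.GeneralizedHardyLittlewood.FordMaynardSieveConst01651SieveDecomposition

/-- `sqfreeMainTerm_of_slice` — lemma of the line skeleton `sieve_decomposition` (v21, seat `linewriter-parity-smallroutes-1`), re-homed verbatim. [folklore] -/
theorem sqfreeMainTerm_of_slice (hS : Signature.sliceMainTerm) : Signature.sqfreeMainTerm := by
  intro ν hν hν4 g hadm ε hε
  classical
  set K : ℕ := ⌊1 / ν⌋₊ with hK
  have hε' : 0 < ε / ((K : ℝ) + 1) := by positivity
  have hk : ∀ k ∈ Icc 2 K, ∃ x₀ : ℝ, ∀ x : ℝ, x₀ ≤ x →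
      |∑ n ∈ SFkset ν x k, starSum g k (vk k n) - sliceIntegral k 1 (sliceTest ν g k) * ((windowPrimes x).card : ℝ)|
        ≤ ε / ((K : ℝ) + 1) * x / Real.log x := by
    intro k hk
    rw [mem_Icc] at hk
    exact hS ν hν hν4 g hadm k hk.1 hk.2 _ hε'
  choose! x₀ hx₀ using hk
  refine ⟨(∑ k ∈ Icc 2 K, |x₀ k|) + 2, fun x hx => ?_⟩
  have hsum0 : 0 ≤ ∑ k ∈ Icc 2 K, |x₀ k| := sum_nonneg fun k _ => abs_nonneg _
  have hx2 : 2 ≤ x := by linarith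
  have hx0 : 0 ≤ x := by linarith
  have hlogpos : 0 < Real.log x := Real.log_pos (by linarith)
  have hxk : ∀ k ∈ Icc 2 K, x₀ k ≤ x := by
    intro k hk
    have h1 : |x₀ k| ≤ ∑ j ∈ Icc 2 K, |x₀ j| := single_le_sum (fun j _ => abs_nonneg (x₀ j)) hk
    linarith [le_abs_self (x₀ k)]
  have hL : ∑ n ∈ SFset ν x, starSum g n.primeFactorsList.length (pvec n n)
      = ∑ k ∈ Icc 2 K, ∑ n ∈ SFkset ν x k, starSum g k (vk k n) := by
    rw [sum_SFset_fiberwise hν]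
    refine sum_congr rfl fun k _ => sum_congr rfl fun n hn => ?_
    rw [mem_SFkset] at hn
    exact (starSum_vk_eq g hn.2).symm
  have hV : sieveBoundG1 ν g - 1 = ∑ k ∈ Icc 2 K, sliceIntegral k 1 (sliceTest ν g k) := by
    rw [sieveBoundG1_eq]; ring
  rw [hL, hV, sum_mul, ← sum_sub_distrib]
  have hK1 : (K : ℝ) + 1 ≠ 0 := by positivity
  have hcard : ((Icc 2 K).card : ℝ) ≤ (K : ℝ) + 1 := by
    have : (Icc 2 K).card ≤ K + 1 := by rw [Nat.card_Icc]; omega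
    exact_mod_cast this
  have hterm0 : 0 ≤ ε / ((K : ℝ) + 1) * x / Real.log x := div_nonneg (mul_nonneg hε'.le hx0) hlogpos.le
  calc |∑ k ∈ Icc 2 K, (∑ n ∈ SFkset ν x k, starSum g k (vk k n)
          - sliceIntegral k 1 (sliceTest ν g k) * ((windowPrimes x).card : ℝ))|
      ≤ ∑ k ∈ Icc 2 K, |∑ n ∈ SFkset ν x k, starSum g k (vk k n)
          - sliceIntegral k 1 (sliceTest ν g k) * ((windowPrimes x).card : ℝ)| := abs_sum_le_sum_abs _ _
    _ ≤ ∑ _k ∈ Icc 2 K, ε / ((K : ℝ) + 1) * x / Real.log x := sum_le_sum fun k hk => hx₀ k hk x (hxk k hk)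
    _ = ((Icc 2 K).card : ℝ) * (ε / ((K : ℝ) + 1) * x / Real.log x) := by rw [sum_const, nsmul_eq_mul]
    _ ≤ ((K : ℝ) + 1) * (ε / ((K : ℝ) + 1) * x / Real.log x) := mul_le_mul_of_nonneg_right hcard hterm0
    _ = ε * x / Real.log x := by field_simp

/-- `isSymmetric_hfun` — lemma of the line skeleton `sieve_decomposition` (v21, seat `linewriter-parity-smallroutes-1`), re-homed verbatim. [folklore] -/
theorem isSymmetric_hfun {ν : ℝ} {g : VecFn} (hs : g.IsSymmetric) (k : ℕ) : (hfun ν g k).IsSymmetric := by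
  intro K σ v
  unfold hfun
  have hiff : (∀ i, ν < (v ∘ σ) i) ↔ ∀ i, ν < v i := by
    constructor
    · intro h i
      have := h (σ.symm i)
      simpa using this
    · intro h i
      exact h (σ i)
  by_cases hc : K = k ∧ ∀ i, ν < v i
  · rw [if_pos hc, if_pos (⟨hc.1, hiff.2 hc.2⟩ : K = k ∧ ∀ i, ν < (v ∘ σ) i), _root_.Summit.Parity.GeneralizedHardyLittlewood.FordMaynardSieveConst01651SieveConst01651.starSum_perm' hs]
  · rw [if_neg hc, if_neg (fun h => hc ⟨h.1, hiff.1 h.2⟩)]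

/-- `rpow_lt_iff_lt_log_div` — lemma of the line skeleton `sieve_decomposition` (v21, seat `linewriter-parity-smallroutes-1`), re-homed verbatim. [folklore] -/
theorem rpow_lt_iff_lt_log_div {ν : ℝ} {n p : ℕ} (hn : 2 ≤ n) (hp : 0 < p) :
    (n : ℝ) ^ ν < (p : ℝ) ↔ ν < Real.log p / Real.log n := by
  have hn0 : (0 : ℝ) < n := by exact_mod_cast (show 0 < n by omega)
  have hlogn : 0 < Real.log n := Real.log_pos (by exact_mod_cast (show 1 < n by omega))
  have hp0 : (0 : ℝ) < p := by exact_mod_cast hp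
  rw [lt_div_iff₀ hlogn, ← Real.log_rpow hn0, Real.log_lt_log_iff (Real.rpow_pos_of_pos hn0 ν) hp0]

/-- `wseq_hfun_eq` — lemma of the line skeleton `sieve_decomposition` (v21, seat `linewriter-parity-smallroutes-1`), re-homed verbatim. [folklore] -/
theorem wseq_hfun_eq {ν x : ℝ} {g : VecFn} (hs : g.IsSymmetric) {k : ℕ} (hk : 2 ≤ k) {n : ℕ}
    (hn : n ∈ window x) :
    wseq (hfun ν g k) n = if n ∈ SFkset ν x k then starSum g k (vk k n) else 0 := by
  classical
  by_cases hsq : Squarefree n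
  swap
  · rw [wseq_of_not_squarefree _ hsq, if_neg]
    rw [mem_SFkset, mem_SFset]
    exact fun h => hsq h.1.2
  have hn0 : n ≠ 0 := hsq.ne_zero
  set L := n.primeFactorsList with hL
  have hnd : L.Nodup := (Nat.squarefree_iff_nodup_primeFactorsList hn0).1 hsq
  let e : Fin L.length ≃ ↥n.primeFactors :=
    (hnd.getEquiv L).trans (Equiv.subtypeEquivRight (fun p => by
      rw [hL, ← Nat.mem_primeFactors_iff_mem_primeFactorsList]))
  have he : ∀ i, ((e i : ℕ) : ℝ) = (L.get i : ℝ) := by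
    intro i; rfl
  rw [wseq_eq_of_equiv (isSymmetric_hfun hs k) hsq e]
  simp only [he]
  unfold hfun
  by_cases hlen : L.length = k
  · -- dimension `k`: the roughness condition is `IsRough`, the value is `(𝟙⋆g)(𝐯ₖ(n))`
    have hn2 : 2 ≤ n := by
      by_contra hlt
      have hn1 : n = 1 := by omega
      have : L.length = 0 := by rw [hL, hn1, Nat.primeFactorsList_one]; rfl
      omega
    have hnp : ¬ n.Prime := by
      intro hpr
      have : L.length = 1 := by rw [hL, Nat.primeFactorsList_prime hpr]; rfl
      omega
    have hrough : (∀ i : Fin L.length, ν < Real.log (L.get i : ℝ) / Real.log n) ↔ IsRough ν n := by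
      constructor
      · intro h p hp
        have hpL : p ∈ L := by rwa [hL, ← Nat.mem_primeFactors_iff_mem_primeFactorsList]
        obtain ⟨i, hi⟩ := List.mem_iff_get.1 hpL
        have hp0 : 0 < p := (Nat.prime_of_mem_primeFactorsList (by rwa [hL] at hpL)).pos
        rw [rpow_lt_iff_lt_log_div hn2 hp0, ← hi]
        exact h i
      · intro h i
        have hpL : L.get i ∈ L := List.get_mem L i
        have hpr : (L.get i).Prime := Nat.prime_of_mem_primeFactorsList (n := n) hpL
        have hpF : L.get i ∈ n.primeFactors := by
          rw [Nat.mem_primeFactors_iff_mem_primeFactorsList, ← hL]; exact hpL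
        rw [← rpow_lt_iff_lt_log_div hn2 hpr.pos]
        exact h _ hpF
    have hval : starSum g L.length (fun i => Real.log (L.get i : ℝ) / Real.log n) = starSum g k (vk k n) := by
      rw [starSum_vk_eq g hlen]
      rfl
    by_cases hr : IsRough ν n
    · rw [if_pos ⟨hlen, hrough.2 hr⟩, hval, if_pos]
      rw [mem_SFkset, mem_SFset, mem_Nset]
      exact ⟨⟨⟨hn, hn2, hnp, hr⟩, hsq⟩, hlen⟩
    · rw [if_neg (fun h => hr (hrough.1 h.2)), if_neg]
      rw [mem_SFkset, mem_SFset, mem_Nset]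
      exact fun h => hr h.1.1.2.2.2
  · rw [if_neg (fun h => hlen h.1), if_neg]
    rw [mem_SFkset]
    exact fun h => hlen h.2

/-- `SFkset_subset_window` — lemma of the line skeleton `sieve_decomposition` (v21, seat `linewriter-parity-smallroutes-1`), re-homed verbatim. [folklore] -/
theorem SFkset_subset_window {ν x : ℝ} {k : ℕ} : SFkset ν x k ⊆ window x := by
  intro n hn
  rw [mem_SFkset, mem_SFset, mem_Nset] at hn
  exact hn.1.1.1

/-- `sum_SFkset_eq_Vsum` — lemma of the line skeleton `sieve_decomposition` (v21, seat `linewriter-parity-smallroutes-1`), re-homed verbatim. [folklore] -/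
theorem sum_SFkset_eq_Vsum {ν x : ℝ} {g : VecFn} (hs : g.IsSymmetric) {k : ℕ} (hk : 2 ≤ k) :
    ∑ n ∈ SFkset ν x k, starSum g k (vk k n) = Vsum (hfun ν g k) x 1 ⌊x⌋₊ := by
  classical
  unfold Vsum
  have hW : (Icc 1 ⌊x⌋₊).filter (fun r : ℕ => x / 2 < ((1 * r : ℕ) : ℝ)) = window x := by
    ext r
    rw [mem_filter, mem_window, mem_Icc, one_mul]
  rw [hW]
  calc ∑ n ∈ SFkset ν x k, starSum g k (vk k n)
      = ∑ n ∈ (window x).filter (fun n => n ∈ SFkset ν x k), starSum g k (vk k n) := by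
        apply sum_congr _ (fun _ _ => rfl)
        ext n
        rw [mem_filter]
        exact ⟨fun h => ⟨SFkset_subset_window h, h⟩, fun h => h.2⟩
    _ = ∑ n ∈ window x, (if n ∈ SFkset ν x k then starSum g k (vk k n) else 0) := sum_filter _ _
    _ = ∑ n ∈ window x, wseq (hfun ν g k) (1 * n) := by
        refine sum_congr rfl fun n hn => ?_
        rw [one_mul, wseq_hfun_eq hs hk hn]

/-- `sliceMainTerm_of_Vsum` — lemma of the line skeleton `sieve_decomposition` (v21, seat `linewriter-parity-smallroutes-1`), re-homed verbatim. [folklore] -/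
theorem sliceMainTerm_of_Vsum (hV : Signature.VsumMainTerm) : Signature.sliceMainTerm := by
  intro ν hν hν4 g hadm k hk hkK ε hε
  obtain ⟨x₀, hx₀⟩ := hV ν hν hν4 g hadm k hk hkK ε hε
  refine ⟨x₀, fun x hx => ?_⟩
  rw [sum_SFkset_eq_Vsum hadm.1 hk]
  exact hx₀ x hx

/-- The summand of the tree's `injSum h x 1 ⌊x⌋ k` is literally `mainG1` (definitional check, `rfl`). -/
example (ν : ℝ) (g : VecFn) (k : ℕ) (x : ℝ) :
    injSum (hfun ν g k) x 1 ⌊x⌋₊ k =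
      ∑ q ∈ (Fintype.piFinset fun _ : Fin k => Nat.primesLE ⌊x⌋₊).filter
          (fun q => Function.Injective q ∧ ∀ i, q i ∉ (1 : ℕ).primeFactors),
        mainG1 ν g k x (logVec x q) := rfl

/-- **The per-dimension main term in §6.2 form from its two halves** (`ε/2 + ε/2`). -/
theorem VsumMainTerm_of (hA : Signature.VsumIntegral) (hB : Signature.integralMainTerm) :
    Signature.VsumMainTerm := by
  intro ν hν hν4 g hadm k hk hkK ε hε
  have hε2 : 0 < ε / 2 := by linarith
  obtain ⟨x₁, hx₁⟩ := hA ν hν hν4 g hadm k hk hkK (ε / 2) hε2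
  obtain ⟨x₂, hx₂⟩ := hB ν hν hν4 g hadm k hk hkK (ε / 2) hε2
  refine ⟨max x₁ x₂, fun x hx => ?_⟩
  have h1 := hx₁ x (le_trans (le_max_left _ _) hx)
  have h2 := hx₂ x (le_trans (le_max_right _ _) hx)
  calc |Vsum (hfun ν g k) x 1 ⌊x⌋₊ - sliceIntegral k 1 (sliceTest ν g k) * ((windowPrimes x).card : ℝ)|
      = |(Vsum (hfun ν g k) x 1 ⌊x⌋₊ - (1 / (k.factorial : ℝ)) * primeTupleIntegral k x (mainG1 ν g k x))
          + ((1 / (k.factorial : ℝ)) * primeTupleIntegral k x (mainG1 ν g k x)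
              - sliceIntegral k 1 (sliceTest ν g k) * ((windowPrimes x).card : ℝ))| := by congr 1; ring
    _ ≤ |Vsum (hfun ν g k) x 1 ⌊x⌋₊ - (1 / (k.factorial : ℝ)) * primeTupleIntegral k x (mainG1 ν g k x)|
          + |(1 / (k.factorial : ℝ)) * primeTupleIntegral k x (mainG1 ν g k x)
              - sliceIntegral k 1 (sliceTest ν g k) * ((windowPrimes x).card : ℝ)| := abs_add_le _ _
    _ ≤ ε / 2 * x / Real.log x + ε / 2 * x / Real.log x := add_le_add h1 h2
    _ = ε * x / Real.log x := by ring

/-- Only the dimension `s = k` survives in `Σ_s (1/s!) injSum_s` for `h = hfun ν g k` (`#primeFactors 1 = 0`). -/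
theorem injSum_hfun_of_ne {ν x : ℝ} {g : VecFn} {k s : ℕ} (hs : s ≠ k) : injSum (hfun ν g k) x 1 ⌊x⌋₊ s = 0 := by
  classical
  unfold injSum
  refine sum_eq_zero fun q _ => ?_
  unfold mainG
  have ht : (1 : ℕ).primeFactors.card + s ≠ k := by
    rw [Nat.primeFactors_one, card_empty, zero_add]; exact hs
  split_ifs
  · exact hfun_of_ne ht _
  · rfl

/-- **`Vsum (hfun ν g k) x 1 ⌊x⌋ = (1/k!)·injSum (hfun ν g k) x 1 ⌊x⌋ k`** (`x ≥ 2`), from the tree's `Vsum_eq_sum_injSum`. -/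
theorem Vsum_hfun_eq {ν x : ℝ} {g : VecFn} (hs : g.IsSymmetric) {k : ℕ} (hk : 2 ≤ k) (hx : 2 ≤ x) :
    Vsum (hfun ν g k) x 1 ⌊x⌋₊ = (1 / (k.factorial : ℝ)) * injSum (hfun ν g k) x 1 ⌊x⌋₊ k := by
  have hvan : ∀ K, k < K → ∀ v, hfun ν g k K v = 0 := fun K hK v => hfun_of_ne (by omega) v
  have hmx : ((1 : ℕ) : ℝ) ≤ x / 2 := by rw [Nat.cast_one]; linarith
  have hR : ((⌊x⌋₊ : ℕ) : ℝ) ≤ x / ((1 : ℕ) : ℝ) := by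
    rw [Nat.cast_one, div_one]; exact Nat.floor_le (by linarith)
  rw [Vsum_eq_sum_injSum (isSymmetric_hfun hs k) hvan (by linarith : (1 : ℝ) < x) (m := 1) squarefree_one hmx hR
    (Smax := k) le_rfl]
  rw [sum_eq_single_of_mem k (by rw [mem_Icc]; omega)]
  intro s _ hsk
  rw [injSum_hfun_of_ne hsk, mul_zero]

/-- **Stub 1a from the injective-tuple form** (the factor `1/k! ≤ 1`). -/
theorem VsumIntegral_of_injSum (h : Signature.injSumIntegral) : Signature.VsumIntegral := by
  intro ν hν hν4 g hadm k hk hkK ε hε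
  obtain ⟨x₀, hx₀⟩ := h ν hν hν4 g hadm k hk hkK ε hε
  refine ⟨max x₀ 2, fun x hx => ?_⟩
  have hx2 : 2 ≤ x := le_trans (le_max_right _ _) hx
  have h1 := hx₀ x (le_trans (le_max_left _ _) hx)
  have hkpos : (0 : ℝ) < 1 / (k.factorial : ℝ) := by positivity
  rw [Vsum_hfun_eq hadm.1 hk hx2, ← mul_sub, abs_mul, abs_of_pos hkpos]
  have hfac : 1 / (k.factorial : ℝ) ≤ 1 := by
    rw [div_le_one (by positivity)]
    have : (1 : ℕ) ≤ k.factorial := Nat.succ_le_of_lt (Nat.factorial_pos k)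
    exact_mod_cast this
  have h0 : 0 ≤ ε * x / Real.log x :=
    div_nonneg (mul_nonneg hε.le (by linarith)) (Real.log_nonneg (by linarith))
  calc 1 / (k.factorial : ℝ) * |injSum (hfun ν g k) x 1 ⌊x⌋₊ k - primeTupleIntegral k x (mainG1 ν g k x)|
      ≤ 1 * (ε * x / Real.log x) := mul_le_mul hfac h1 (abs_nonneg _) zero_le_one
    _ = ε * x / Real.log x := one_mul _

/-- A symmetric piecewise-constant-on-the-cone `g` is bounded in each dimension (all inputs, by sorting). -/
theorem exists_abs_apply_le {g : VecFn} (hs : g.IsSymmetric) (hpc : IsPiecewiseConstOnCone g) (K : ℕ) :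
    ∃ C : ℝ, ∀ v : Fin K → ℝ, |g K v| ≤ C := by
  classical
  obtain ⟨m, P, c, hP, hg⟩ := hpc K
  refine ⟨∑ j, |c j|, fun v => ?_⟩
  have hmono : Monotone (v ∘ Tuple.sort v) := Tuple.monotone_sort v
  rw [← hs K (Tuple.sort v) v, hg _ hmono]
  calc |∑ j, (if (v ∘ Tuple.sort v) ∈ P j then c j else 0)|
      ≤ ∑ j, |if (v ∘ Tuple.sort v) ∈ P j then c j else 0| := abs_sum_le_sum_abs _ _
    _ ≤ ∑ j, |c j| := sum_le_sum fun j _ => by split_ifs <;> simp [abs_nonneg]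

/-- `exists_abs_starSum_le` — lemma of the line skeleton `sieve_decomposition` (v21, seat `linewriter-parity-smallroutes-1`), re-homed verbatim. [folklore] -/
theorem exists_abs_starSum_le {g : VecFn} (hs : g.IsSymmetric) (hpc : IsPiecewiseConstOnCone g) (K : ℕ) :
    ∃ S : ℝ, ∀ v : Fin K → ℝ, |starSum g K v| ≤ S := by
  classical
  have hC := fun j => exists_abs_apply_le hs hpc j
  choose C hC using hC
  refine ⟨∑ A : Finset (Fin K), C A.card, fun v => ?_⟩
  unfold starSum
  calc |∑ A : Finset (Fin K), g A.card (fun i => v (A.orderEmbOfFin rfl i))|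
      ≤ ∑ A : Finset (Fin K), |g A.card (fun i => v (A.orderEmbOfFin rfl i))| := abs_sum_le_sum_abs _ _
    _ ≤ ∑ A : Finset (Fin K), C A.card := sum_le_sum fun A _ => hC _ _

/-- `hfun_ne_zero_imp` — lemma of the line skeleton `sieve_decomposition` (v21, seat `linewriter-parity-smallroutes-1`), re-homed verbatim. [folklore] -/
theorem hfun_ne_zero_imp {ν : ℝ} {g : VecFn} {k K : ℕ} {v : Fin K → ℝ} (h : hfun ν g k K v ≠ 0) : ∀ i, ν ≤ v i := by
  unfold hfun at h
  by_cases hc : K = k ∧ ∀ i, ν < v i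
  · exact fun i => (hc.2 i).le
  · rw [if_neg hc] at h; exact absurd rfl h

/-- `exists_abs_hfun_le` — lemma of the line skeleton `sieve_decomposition` (v21, seat `linewriter-parity-smallroutes-1`), re-homed verbatim. [folklore] -/
theorem exists_abs_hfun_le {g : VecFn} (hs : g.IsSymmetric) (hpc : IsPiecewiseConstOnCone g) (ν : ℝ) (k : ℕ) :
    ∃ Hb : ℝ, ∀ (K : ℕ) (v : Fin K → ℝ), |hfun ν g k K v| ≤ Hb := by
  obtain ⟨S, hS⟩ := exists_abs_starSum_le hs hpc k
  refine ⟨max S 0, fun K v => ?_⟩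
  unfold hfun
  by_cases hc : K = k ∧ ∀ i, ν < v i
  · rw [if_pos hc]
    obtain ⟨rfl, -⟩ := hc
    exact (hS v).trans (le_max_left _ _)
  · rw [if_neg hc, abs_zero]; exact le_max_right _ _

/-- The range condition `hρ` of the tree lemmas at `m = 1`: `1/2 ≤ 0 + log(x/2)/log x` for `x ≥ 4`. -/
theorem hrho_one {x : ℝ} (hx : 4 ≤ x) :
    1 / 2 ≤ (∑ i, uvec x 1 i) + Real.log (x / (2 * ((1 : ℕ) : ℝ))) / Real.log x := by
  have ht : (1 : ℕ).primeFactors.card = 0 := by rw [Nat.primeFactors_one, card_empty]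
  have hsum : (∑ i, uvec x 1 i) = 0 :=
    sum_eq_zero fun i _ => by exfalso; have hi := i.isLt; omega
  have hx0 : 0 < x := by linarith
  have hlogpos : 0 < Real.log x := Real.log_pos (by linarith)
  have hlog4 : Real.log 4 ≤ Real.log x := Real.log_le_log (by norm_num) hx
  have hlog22 : Real.log 4 = Real.log 2 + Real.log 2 := by
    rw [show (4 : ℝ) = 2 * 2 by norm_num, Real.log_mul (by norm_num) (by norm_num)]
  rw [hsum, zero_add, Nat.cast_one, mul_one, Real.log_div hx0.ne' (by norm_num), le_div_iff₀ hlogpos]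
  linarith

end Summit.Parity.GeneralizedHardyLittlewood.FordMaynardSieveConst01651SieveDecomposition

end
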